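import Mathlib
import Literature.Analysis.FluidPDE.VectorCalculus
import Summits.NavierStokesRegularity.NavierStokesRegularity.Theorems.FilamentSkeletonRssClause13RCokernelCertificate
import Summits.NavierStokesRegularity.NavierStokesRegularity.Theorems.FilamentSkeletonRssClause13RClausePairing

/-!
# STUB R from an ADJOINT-KERNEL CERTIFICATE: the registered rate row `RateRow13RFlat` follows from a `C¹` solution of the explicit adjoint equation
# `(D^*ψ)_k = 0` on the tangency balls with positive mass and the pairing floor
# (crux `Clause13RNearStraightL`, stmt-NavierStokesRegularity-23612; line `rate_bordered_split`, STUB R `stub_rateRow13RFlat`)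

Route `FilamentSkeletonRss`, Variant A1R.  `…Clause13RCokernelCertificate.rateRow13RFlat_of_cokernelCertificate` (fsrs-8-g1, census item (e)) reduces the
registered STUB R to a continuous `ψ` on the balls with positive mass, pairing floor `√Γ/cnd` against the rate column, and EXACT ANNIHILATION of
`DT·Y` for every admissible `Y`.  With census item (a) done (`…Clause13RClausePairing.clause_pairing_identity`: the annihilation functional equals
`Σ_k ∫_{S_k} ⟪(D^*ψ)_k, Y_k⟫` for the EXPLICIT adjoint operator of `…Clause13RAdjointOperator`), the annihilation clause is discharged by the POINTWISE
adjoint equation.  THIS FILE states the resulting **adjoint-kernel certificate** — the cokernel certificate with `ψ ∈ C¹` and the annihilation clause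
replaced by `∀ k, ∀ σ ∈ S_k, (D^*ψ)_k(σ) = 0` (written out) — and proves

* `integrableOn_inner_closedForm` / `integrableOn_inner_linearisedMap` — the certificate's integrability clause (analytic level / clause level);
* **`rateRow13RFlat_of_adjointKernelCertificate` : ADJOINT-KERNEL CERTIFICATE → STUB R (verbatim text of the registered `RateRow13RFlat`)**
  (`Γ₀ := max Γ₀ 2` so that the balls have positive radius).

So the open content of STUB R along route (ii′) is exactly census item (c): for all large `Γ` and every skeleton of the class, CONSTRUCT `ψ ∈ C¹` solving
`(D^*ψ)_k = 0` on every ball with `Σ_j∫_{S_j}‖ψ_j‖ > 0` and `(√Γ/cnd)Σ_j∫_{S_j}‖ψ_j‖ ≤ Σ_j∫_{S_j}⟪ψ_j, R_j⟫` (memo STRUCTURE-23612-conformal-cokernel-leafhand8-g1.md: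
near the tilt mode `τ(e₃ × d)`).  Hand `leafhand-ns-filamentskeletonrs-10-g0` (LAND-ONLY); `--supports stmt-NavierStokesRegularity-23612` helper.
HONEST FRAMING: duality bookkeeping at a HYPOTHETICAL near-straight filament skeleton on the NEGATIVE side of a MODEL blow-up route; STUB R is NOT proved
here (no `ψ` is constructed) and nothing in this file bears on Navier–Stokes regularity or blow-up.
-/

noncomputable section

open MeasureTheory Filter Topology Set
open scoped RealInnerProductSpace InnerProductSpace BigOperators
open Literature.Analysis.FluidPDE
open Summit.NavierStokesRegularity.NavierStokesRegularity.Theorems.Clause13LinearisedMapClauses (linearGrowth_of_cone deriv_linearisedMap_inBall)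
open Summit.NavierStokesRegularity.NavierStokesRegularity.Theorems.Clause13RCokernelCertificate (rateRow13RFlat_of_cokernelCertificate isCompact_ball_of_cocompact measurableSet_ball)
open Summit.NavierStokesRegularity.NavierStokesRegularity.Theorems.Clause13RStationContinuity
open Summit.NavierStokesRegularity.NavierStokesRegularity.Theorems.Clause13RClosedFormAdjoint
open Summit.NavierStokesRegularity.NavierStokesRegularity.Theorems.Clause13RClausePairing (clause_pairing_identity)

namespace Summit.NavierStokesRegularity.NavierStokesRegularity.Theorems.Clause13RAdjointKernelCertificate
set_option linter.dupNamespace false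

/-! ## §1 Integrability of the pairing density on the ball -/

/-- The pairing density `τ ↦ ⟪ψτ, E_j(τ)⟫` of the closed form is integrable on the compact ball (analytic level; hypotheses as in
`…Clause13RClosedFormAdjoint.setIntegral_inner_closedForm_eq`). [folklore] -/
theorem integrableOn_inner_closedForm {N : ℕ} {ℓ m₀ c C α : ℝ} {y ψ YJ : ℝ → EuclideanSpace ℝ (Fin 3)} {w : ℝ → ℝ}
    {X Y : Fin N → ℝ → EuclideanSpace ℝ (Fin 3)} {m : Fin N → ℝ → ℝ} (cc : Fin N → ℝ)
    (hy : ContDiff ℝ 2 y) (hS : IsCompact {σ : ℝ | ‖y σ‖ ≤ ℓ}) (hw : Differentiable ℝ w) (hψ : ContDiff ℝ 1 ψ) (hYJ : ContDiff ℝ 1 YJ)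
    (hm₀ : 0 < m₀) (hm : ∀ k σ, m₀ ≤ m k σ) (hmc : ∀ k, Continuous (m k)) (hc : 0 < c) (hX : ∀ k, ContDiff ℝ 1 (X k))
    (hX1 : ∀ k σ, ‖deriv (X k) σ‖ ≤ 1) (hXg : ∀ k σ, c * |σ| - C ≤ ‖X k σ‖) (hY : ∀ k, ContDiff ℝ 1 (Y k)) (hYc : ∀ k, HasCompactSupport (Y k)) :
    IntegrableOn (fun τ => ⟪ψ τ,
        ((∑ k, cc k • ∫ σ, ((-3 * ⟪y τ - X k σ, YJ τ - Y k σ⟫ * ((‖y τ - X k σ‖ ^ 2 + m k σ) ^ (5 / 2 : ℝ))⁻¹) • cross (deriv (X k) σ) (y τ - X k σ)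
            + ((‖y τ - X k σ‖ ^ 2 + m k σ) ^ (3 / 2 : ℝ))⁻¹ • (cross (deriv (X k) σ) (YJ τ - Y k σ) + cross (deriv (Y k) σ) (y τ - X k σ))))
          + (1 / 2 : ℝ) • YJ τ - α • cross (EuclideanSpace.single 2 1) (YJ τ))
        - ⟪(∑ k, cc k • ∫ σ, ((-3 * ⟪y τ - X k σ, YJ τ - Y k σ⟫ * ((‖y τ - X k σ‖ ^ 2 + m k σ) ^ (5 / 2 : ℝ))⁻¹) • cross (deriv (X k) σ) (y τ - X k σ)
            + ((‖y τ - X k σ‖ ^ 2 + m k σ) ^ (3 / 2 : ℝ))⁻¹ • (cross (deriv (X k) σ) (YJ τ - Y k σ) + cross (deriv (Y k) σ) (y τ - X k σ))))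
          + (1 / 2 : ℝ) • YJ τ - α • cross (EuclideanSpace.single 2 1) (YJ τ), deriv y τ⟫ • deriv y τ
        + ((w τ * ⟪deriv y τ, deriv YJ τ⟫) • deriv y τ - w τ • deriv YJ τ)⟫) {σ : ℝ | ‖y σ‖ ≤ ℓ} := by
  have hy1 : ContDiff ℝ 1 y := hy.of_le (by norm_num)
  have hyc : Continuous y := hy.continuous
  have hy'c : Continuous (deriv y) := hy.continuous_deriv (by norm_num)
  have hψc : Continuous ψ := hψ.continuous
  have hYJc : Continuous YJ := hYJ.continuous
  have hφc : Continuous fun τ => ψ τ - ⟪ψ τ, deriv y τ⟫ • deriv y τ := by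
    have hi : Continuous fun τ => ⟪ψ τ, deriv y τ⟫ := hψc.inner hy'c
    exact hψc.sub (hi.smul hy'c)
  have hyS : ∀ τ ∈ {σ : ℝ | ‖y σ‖ ≤ ℓ}, ‖y τ‖ ≤ ℓ := fun τ hτ => hτ
  have iK : ∀ k, IntegrableOn (fun τ => cc k * ⟪ψ τ - ⟪ψ τ, deriv y τ⟫ • deriv y τ,
        ∫ σ, ((-3 * ⟪y τ - X k σ, YJ τ - Y k σ⟫ * ((‖y τ - X k σ‖ ^ 2 + m k σ) ^ (5 / 2 : ℝ))⁻¹) • cross (deriv (X k) σ) (y τ - X k σ)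
            + ((‖y τ - X k σ‖ ^ 2 + m k σ) ^ (3 / 2 : ℝ))⁻¹ • (cross (deriv (X k) σ) (YJ τ - Y k σ) + cross (deriv (Y k) σ) (y τ - X k σ)))⟫) {σ : ℝ | ‖y σ‖ ≤ ℓ} :=
    fun k => (integrableOn_inner_integral_variation hS hyc hφc hYJc hyS hm₀ (hm k) (hmc k) hc (hX k) (hX1 k) (hXg k) (hY k) (hYc k)).const_mul _
  have iSum : IntegrableOn (fun τ => ∑ k, cc k * ⟪ψ τ - ⟪ψ τ, deriv y τ⟫ • deriv y τ,
        ∫ σ, ((-3 * ⟪y τ - X k σ, YJ τ - Y k σ⟫ * ((‖y τ - X k σ‖ ^ 2 + m k σ) ^ (5 / 2 : ℝ))⁻¹) • cross (deriv (X k) σ) (y τ - X k σ)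
            + ((‖y τ - X k σ‖ ^ 2 + m k σ) ^ (3 / 2 : ℝ))⁻¹ • (cross (deriv (X k) σ) (YJ τ - Y k σ) + cross (deriv (Y k) σ) (y τ - X k σ)))⟫) {σ : ℝ | ‖y σ‖ ≤ ℓ} :=
    integrable_finsetSum (μ := volume.restrict {σ : ℝ | ‖y σ‖ ≤ ℓ}) Finset.univ fun k _ => iK k
  have hl1 : Continuous fun τ => (1 / 2 : ℝ) • (ψ τ - ⟪ψ τ, deriv y τ⟫ • deriv y τ) := hφc.const_smul (1 / 2 : ℝ)
  have hl2 : Continuous fun τ => α • cross (EuclideanSpace.single 2 1) (ψ τ - ⟪ψ τ, deriv y τ⟫ • deriv y τ) :=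
    ((crossCLM (EuclideanSpace.single 2 1)).continuous.comp hφc).const_smul α
  have hl3 : Continuous fun τ => ⟪(1 / 2 : ℝ) • (ψ τ - ⟪ψ τ, deriv y τ⟫ • deriv y τ)
        + α • cross (EuclideanSpace.single 2 1) (ψ τ - ⟪ψ τ, deriv y τ⟫ • deriv y τ), YJ τ⟫ := (hl1.add hl2).inner hYJc
  have iLoc : IntegrableOn (fun τ => ⟪(1 / 2 : ℝ) • (ψ τ - ⟪ψ τ, deriv y τ⟫ • deriv y τ)
        + α • cross (EuclideanSpace.single 2 1) (ψ τ - ⟪ψ τ, deriv y τ⟫ • deriv y τ), YJ τ⟫) {σ : ℝ | ‖y σ‖ ≤ ℓ} :=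
    hl3.continuousOn.integrableOn_compact hS
  have iSlip := integrableOn_inner_slip hS hy1 hw.continuous hψc hYJ
  refine ((iSum.add iLoc).add iSlip).congr_fun (fun τ _ => ?_) hS.measurableSet
  simp only [Pi.add_apply]
  rw [inner_closedForm_eq, inner_velocityPart_eq]

/-- **Integrability clause of the certificate, at clause level**: for `Γ > 1`, a `C¹` weight family and a `C²` test family vanishing off the balls,
`τ ↦ ⟪ψ_jτ, deriv (fun s => T (X + sY) j τ) 0⟫` is integrable on `S_j`. [folklore] -/
theorem integrableOn_inner_linearisedMap {N : ℕ} {δ ρ K Λ Rw cg θ₀ KA Rb Γ α : ℝ} {γ : Fin N → ℝ} {X : Fin N → ℝ → EuclideanSpace ℝ (Fin 3)} {w : Fin N → ℝ → ℝ}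
    {c : Fin N → ℝ} {Aa : Fin N → ℝ → ℝ} (hN : 0 < N) (hδ : 0 < δ) (hcg : 0 < cg)
    (hH : (∀ (u:(Fin N → ℝ → EuclideanSpace ℝ (Fin 3)) → EuclideanSpace ℝ (Fin 3) → EuclideanSpace ℝ (Fin 3)) (v:EuclideanSpace ℝ (Fin 3) → EuclideanSpace ℝ (Fin 3)) (A:Fin N → (EuclideanSpace ℝ (Fin 3) →L[ℝ] EuclideanSpace ℝ (Fin 3))) (T:(Fin N → ℝ → EuclideanSpace ℝ (Fin 3)) → Fin N → ℝ → EuclideanSpace ℝ (Fin 3)), (∀ Z y, u Z y = ∑ k, (Γ*γ k/(4*Real.pi))•∫ σ:ℝ, ((‖y-Z k σ‖^2+Real.exp (-(1+Real.eulerMascheroniConstant-Real.log 2))*Aa k σ)^(3/2:ℝ))⁻¹•cross (deriv (Z k) σ) (y-Z k σ))→(∀ y, v y = u X y+(1/2:ℝ)•y-α•cross (EuclideanSpace.single 2 1) y)→(∀ j, A j = fderiv ℝ v (X j (c j)))→(∀ Z j τ, T Z j τ = (u Z (Z j τ)+(1/2:ℝ)•Z j τ-α•cross (EuclideanSpace.single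 2 1) (Z j τ))-(⟪u Z (Z j τ)+(1/2:ℝ)•Z j τ-α•cross (EuclideanSpace.single 2 1) (Z j τ), deriv (Z j) τ⟫_ℝ/‖deriv (Z j) τ‖^2)•deriv (Z j) τ)→(α ≠ 0 ∧ (∀ j, γ j ≠ 0) ∧ (∀ j, ContDiff ℝ 2 (X j) ∧ Differentiable ℝ (w j)∧(∀ τ, ‖deriv (X j) τ‖ = 1)∧(∀ τ, ‖iteratedDeriv 2 (X j) τ‖*√Γ≤K) ∧ Tendsto (fun τ => ‖X j τ‖) (cocompact ℝ) atTop) ∧ (∀ j k, j ≠ k → ∀ τ σ, ρ*√Γ≤‖X j τ-X k σ‖) ∧ (∀ j τ σ, ρ*√Γ≤|τ-σ| → cg*ρ*√Γ≤‖X j τ-X j σ‖) ∧ (∀ j τ, cg*|τ-c j|≤Rw*√Γ+‖X j τ‖) ∧ (∀ j τ, w j τ = ⟪v (X j τ), deriv (X j) τ⟫_ℝ) ∧ (∀ j τ, ‖X j τ‖≤Rb*√(Γ*Real.log Γ) → v (X j τ) = w j τ•deriv (X j) τ) ∧ (∀ j, ‖X j (c j)‖≤Rw*√Γ) ∧ (∀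 j, |⟪deriv (X j) (c j), EuclideanSpace.single 2 1⟫_ℝ|≤1-θ₀) ∧ (θ₀≤|α| ∧ |α|≤θ₀⁻¹ ∧ ∀ j, θ₀≤|γ j| ∧ |γ j|≤θ₀⁻¹) ∧ (∀ j, w j (c j) = 0 ∧ (∀ τ, w j τ = 0 → τ = c j) ∧ 3/2+δ≤deriv (w j) (c j) ∧ deriv (w j) (c j)≤Λ) ∧ (∀ j, Differentiable ℝ (Aa j) ∧ (∀ τ, 0 < Aa j τ) ∧ 1≤KA*Aa j (c j) ∧ ∀ τ, ‖X j τ‖≤2*Rb*√(Γ*Real.log Γ) → Aa j τ = Aa j (c j)) ∧ (∀ j τ, Rw^2*Γ*Aa j τ≤KA*(Rw^2*Γ+‖X j τ‖^2)))))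
    (hNS : ((∀ j τ σ, ‖deriv (X j) τ - deriv (X j) σ‖ ≤ Rb) ∧ (∀ j τ, |deriv (w j) τ| ≤ Λ) ∧ (∀ j τ, Λ⁻¹ ≤ Aa j τ)))
    {u : (Fin N → ℝ → EuclideanSpace ℝ (Fin 3)) → EuclideanSpace ℝ (Fin 3) → EuclideanSpace ℝ (Fin 3)} {v : EuclideanSpace ℝ (Fin 3) → EuclideanSpace ℝ (Fin 3)} {A : Fin N → (EuclideanSpace ℝ (Fin 3) →L[ℝ] EuclideanSpace ℝ (Fin 3))}
    {T : (Fin N → ℝ → EuclideanSpace ℝ (Fin 3)) → Fin N → ℝ → EuclideanSpace ℝ (Fin 3)}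
    (hu : ∀ Z y, u Z y = ∑ k, (Γ*γ k/(4*Real.pi))•∫ σ:ℝ, ((‖y-Z k σ‖^2+Real.exp (-(1+Real.eulerMascheroniConstant-Real.log 2))*Aa k σ)^(3/2:ℝ))⁻¹•cross (deriv (Z k) σ) (y-Z k σ)) (hv : ∀ y, v y = u X y+(1/2:ℝ)•y-α•cross (EuclideanSpace.single 2 1) y) (hA : ∀ j, A j = fderiv ℝ v (X j (c j)))
    (hT : ∀ Z j τ, T Z j τ = (u Z (Z j τ)+(1/2:ℝ)•Z j τ-α•cross (EuclideanSpace.single 2 1) (Z j τ))-(⟪u Z (Z j τ)+(1/2:ℝ)•Z j τ-α•cross (EuclideanSpace.single 2 1) (Z j τ), deriv (Z j) τ⟫_ℝ/‖deriv (Z j) τ‖^2)•deriv (Z j) τ)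
    (ψ : Fin N → ℝ → EuclideanSpace ℝ (Fin 3)) (hψ : ∀ j, ContDiff ℝ 1 (ψ j))
    (Y : Fin N → ℝ → EuclideanSpace ℝ (Fin 3)) (hY2 : ∀ j, ContDiff ℝ 2 (Y j)) (hYoff : ∀ j τ, Rb*√(Γ*Real.log Γ) < ‖X j τ‖ → Y j τ = 0) (j : Fin N) :
    IntegrableOn (fun τ => ⟪ψ j τ, deriv (fun s:ℝ => T (fun k σ => X k σ+s•Y k σ) j τ) 0⟫) {σ : ℝ | ‖X j σ‖ ≤ Rb * √(Γ * Real.log Γ)} := by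
  obtain ⟨-, -, h3, -, -, h6, -, h8, -, -, -, h12, h13, -⟩ := hH u v A T hu hv hA hT
  obtain ⟨-, hwΛ, hAfl⟩ := hNS
  have hΛ : 0 < Λ := by
    obtain ⟨-, -, hlo, hhi⟩ := h12 ⟨0, hN⟩
    linarith
  have hκ : 0 < Real.exp (-(1+Real.eulerMascheroniConstant-Real.log 2)) := Real.exp_pos _
  have hX2 : ∀ k, ContDiff ℝ 2 (X k) := fun k => (h3 k).1
  have hunit : ∀ k σ, ‖deriv (X k) σ‖ = 1 := fun k σ => (h3 k).2.2.1 σ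
  have hX1c : ∀ k, ContDiff ℝ 1 (X k) := fun k => (hX2 k).of_le (by norm_num)
  have hX1 : ∀ k σ, ‖deriv (X k) σ‖ ≤ 1 := fun k σ => (hunit k σ).le
  have hXg : ∀ k σ, cg * |σ| - (Rw * Real.sqrt Γ + cg * ∑ i, |c i|) ≤ ‖X k σ‖ := fun k σ => linearGrowth_of_cone hcg h6 k σ
  have hS : ∀ j, IsCompact {σ : ℝ | ‖X j σ‖ ≤ Rb * √(Γ * Real.log Γ)} := fun j => isCompact_ball_of_cocompact (h3 j).1.continuous (h3 j).2.2.2.2 _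
  have hw : ∀ j, Differentiable ℝ (w j) := fun j => (h3 j).2.1
  have hY1 : ∀ k, ContDiff ℝ 1 (Y k) := fun k => (hY2 k).of_le (by norm_num)
  have hAd : ∀ k, Differentiable ℝ (Aa k) := fun k => (h13 k).1
  have hm₀ : 0 < Real.exp (-(1+Real.eulerMascheroniConstant-Real.log 2)) * Λ⁻¹ := mul_pos hκ (inv_pos.2 hΛ)
  have hm : ∀ k σ, Real.exp (-(1+Real.eulerMascheroniConstant-Real.log 2)) * Λ⁻¹ ≤ Real.exp (-(1+Real.eulerMascheroniConstant-Real.log 2)) * Aa k σ := fun k σ => mul_le_mul_of_nonneg_left (hAfl k σ) hκ.le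
  have hmc : ∀ k, Continuous fun σ => Real.exp (-(1+Real.eulerMascheroniConstant-Real.log 2)) * Aa k σ := fun k => continuous_const.mul (hAd k).continuous
  have hYcs : ∀ k, HasCompactSupport (Y k) := fun k =>
    HasCompactSupport.of_support_subset_isCompact (hS k) fun τ hτ => by
      by_contra hn
      exact hτ (hYoff k τ (not_le.1 hn))
  have hcl : ∀ τ ∈ {σ : ℝ | ‖X j σ‖ ≤ Rb * √(Γ * Real.log Γ)}, ⟪ψ j τ, deriv (fun s:ℝ => T (fun k σ => X k σ+s•Y k σ) j τ) 0⟫ = ⟪ψ j τ, (((∑ k, (Γ * γ k / (4 * Real.pi)) • ∫ σ, ((-3 * ⟪X j τ - X k σ, Y j τ - Y k σ⟫ * ((‖X j τ - X k σ‖ ^ 2 + Real.exp (-(1+Real.eulerMascheroniConstant-Real.log 2)) * Aa k σ) ^ (5 / 2 : ℝ))⁻¹) • cross (deriv (X k) σ) (X j τ - X k σ) + ((‖X j τ - X k σ‖ ^ 2 + Real.exp (-(1+Real.eulerMascheroniConstant-Real.log 2)) * Aa k σ) ^ (3 / 2 : ℝ))⁻¹ • (cross (deriv (X k) σ) (Y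 j τ - Y k σ) + cross (deriv (Y k) σ) (X j τ - X k σ)))) + (1 / 2 : ℝ) • Y j τ - α • cross (EuclideanSpace.single 2 1) (Y j τ)) - ⟪((∑ k, (Γ * γ k / (4 * Real.pi)) • ∫ σ, ((-3 * ⟪X j τ - X k σ, Y j τ - Y k σ⟫ * ((‖X j τ - X k σ‖ ^ 2 + Real.exp (-(1+Real.eulerMascheroniConstant-Real.log 2)) * Aa k σ) ^ (5 / 2 : ℝ))⁻¹) • cross (deriv (X k) σ) (X j τ - X k σ) + ((‖X j τ - X k σ‖ ^ 2 + Real.exp (-(1+Real.eulerMascheroniConstant-Real.log 2)) * Aa k σ) ^ (3 / 2 : ℝ))⁻¹ • (cross (deriv (X k) σ) (Y j τ - Y k σ) + cross (deriv (Y k) σ) (X j τ - X k σ)))) + (1 / 2 : ℝ) • Y j τ - α • cross (EuclideanSpace.single 2 1) (Y j τ)), deriv (X j) τ⟫ • deriv (X j) τ + ((w j τ * ⟪deriv (X j) τ, deriv (Y j) τ⟫) • deriv (X j) τ - w j τ • deriv (Y j) τ))⟫ := by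
    intro τ hτ
    have hin : ‖X j τ‖ ≤ Rb * Real.sqrt (Γ * Real.log Γ) := hτ
    rw [deriv_linearisedMap_inBall hu hv hT hX2 hunit hcg h6 h8 hAd (inv_pos.2 hΛ) hAfl hY2 hYoff j τ hin, add_sub_assoc]
  exact (integrableOn_inner_closedForm (m := fun k σ => Real.exp (-(1+Real.eulerMascheroniConstant-Real.log 2)) * Aa k σ) (fun k => (Γ * γ k / (4 * Real.pi))) (hX2 j) (hS j) (hw j) (hψ j) (hY1 j)
    hm₀ hm hmc hcg hX1c hX1 hXg hY1 hYcs).congr_fun (fun τ hτ => (hcl τ hτ).symm) (measurableSet_ball (h3 j).1.continuous _)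

/-! ## §2 The adjoint-kernel certificate implies STUB R -/

/-- **ADJOINT-KERNEL CERTIFICATE ⟹ STUB R** (`RateRow13RFlat`, verbatim).  The hypothesis is the cokernel certificate of
`…Clause13RCokernelCertificate` with `ψ ∈ C¹` and the annihilation clause replaced by the pointwise adjoint equation `(D^*ψ)_k = 0` on every ball
(explicit operator of `…Clause13RAdjointOperator` with `c_k = Γγ_k/4π`, core `κ·Aa_k`, constant value `κ·Aa_k(c_k)`). [folklore] -/
theorem rateRow13RFlat_of_adjointKernelCertificate :
    ((open Literature.Analysis.FluidPDE in ∀ (N : ℕ) (δ ρ K Λ Rw cg θ₀ KA : ℝ), 0 < N → 0 < δ → 0 < ρ → 0 < Rw → 0 < cg → 0 < θ₀ → ∃ Rb₀ : ℝ, 0 < Rb₀ ∧ ∀ Rb : ℝ, 0 < Rb → Rb ≤ Rb₀ → ∃ (cnd Γ₀ : ℝ), 0 < cnd ∧ ∀ Γ : ℝ, Γ₀ ≤ Γ → ∀ (γ : Fin N → ℝ) (α : ℝ) (X : Fin N → ℝ → EuclideanSpace ℝ (Fin 3)) (w : Fin N → ℝ → ℝ) (c : Fin N → ℝ) (Aa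 : Fin N → ℝ → ℝ), (∀ (u:(Fin N → ℝ → EuclideanSpace ℝ (Fin 3)) → EuclideanSpace ℝ (Fin 3) → EuclideanSpace ℝ (Fin 3)) (v:EuclideanSpace ℝ (Fin 3) → EuclideanSpace ℝ (Fin 3)) (A:Fin N → (EuclideanSpace ℝ (Fin 3) →L[ℝ] EuclideanSpace ℝ (Fin 3))) (T:(Fin N → ℝ → EuclideanSpace ℝ (Fin 3)) → Fin N → ℝ → EuclideanSpace ℝ (Fin 3)), (∀ Z y, u Z y = ∑ k, (Γ*γ k/(4*Real.pi))•∫ σ:ℝ, ((‖y-Z k σ‖^2+Real.exp (-(1+Real.eulerMascheroniConstant-Real.log 2))*Aa k σ)^(3/2:ℝ))⁻¹•cross (deriv (Z k) σ) (y-Z k σ))→(∀ y, v y = u X y+(1/2:ℝ)•y-α•cross (EuclideanSpace.single 2 1) y)→(∀ j, A j = fderiv ℝ v (X j (c j)))→(∀ Z j τ, T Z j τ = (u Z (Z j τ)+(1/2:ℝ)•Z j τ-α•cross (EuclideanSpace.single 2 1) (Z j τ))-(⟪u Z (Z j τ)+(1/2:ℝ)•Z j τ-α•cross (EuclideanSpace.single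 2 1) (Z j τ), deriv (Z j) τ⟫_ℝ/‖deriv (Z j) τ‖^2)•deriv (Z j) τ)→(α ≠ 0 ∧ (∀ j, γ j ≠ 0) ∧ (∀ j, ContDiff ℝ 2 (X j) ∧ Differentiable ℝ (w j)∧(∀ τ, ‖deriv (X j) τ‖ = 1)∧(∀ τ, ‖iteratedDeriv 2 (X j) τ‖*√Γ≤K) ∧ Tendsto (fun τ => ‖X j τ‖) (cocompact ℝ) atTop) ∧ (∀ j k, j ≠ k → ∀ τ σ, ρ*√Γ≤‖X j τ-X k σ‖) ∧ (∀ j τ σ, ρ*√Γ≤|τ-σ| → cg*ρ*√Γ≤‖X j τ-X j σ‖) ∧ (∀ j τ, cg*|τ-c j|≤Rw*√Γ+‖X j τ‖) ∧ (∀ j τ, w j τ = ⟪v (X j τ), deriv (X j) τ⟫_ℝ) ∧ (∀ j τ, ‖X j τ‖≤Rb*√(Γ*Real.log Γ) → v (X j τ) = w j τ•deriv (X j) τ) ∧ (∀ j, ‖X j (c j)‖≤Rw*√Γ) ∧ (∀ j, |⟪deriv (X j) (c j), EuclideanSpace.single 2 1⟫_ℝ|≤1-θ₀) ∧ (θ₀≤|α|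 ∧ |α|≤θ₀⁻¹ ∧ ∀ j, θ₀≤|γ j| ∧ |γ j|≤θ₀⁻¹) ∧ (∀ j, w j (c j) = 0 ∧ (∀ τ, w j τ = 0 → τ = c j) ∧ 3/2+δ≤deriv (w j) (c j) ∧ deriv (w j) (c j)≤Λ) ∧ (∀ j, Differentiable ℝ (Aa j) ∧ (∀ τ, 0 < Aa j τ) ∧ 1≤KA*Aa j (c j) ∧ ∀ τ, ‖X j τ‖≤2*Rb*√(Γ*Real.log Γ) → Aa j τ = Aa j (c j)) ∧ (∀ j τ, Rw^2*Γ*Aa j τ≤KA*(Rw^2*Γ+‖X j τ‖^2)))) → ((∀ j τ σ, ‖deriv (X j) τ - deriv (X j) σ‖ ≤ Rb) ∧ (∀ j τ, |deriv (w j) τ| ≤ Λ) ∧ (∀ j τ, Λ⁻¹ ≤ Aa j τ)) → (∀ (u:(Fin N → ℝ → EuclideanSpace ℝ (Fin 3)) → EuclideanSpace ℝ (Fin 3) → EuclideanSpace ℝ (Fin 3)) (v:EuclideanSpace ℝ (Fin 3) → EuclideanSpace ℝ (Fin 3)) (A:Fin N → (EuclideanSpace ℝ (Fin 3) →L[ℝ]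 EuclideanSpace ℝ (Fin 3))) (T:(Fin N → ℝ → EuclideanSpace ℝ (Fin 3)) → Fin N → ℝ → EuclideanSpace ℝ (Fin 3)), (∀ Z y, u Z y = ∑ k, (Γ*γ k/(4*Real.pi))•∫ σ:ℝ, ((‖y-Z k σ‖^2+Real.exp (-(1+Real.eulerMascheroniConstant-Real.log 2))*Aa k σ)^(3/2:ℝ))⁻¹•cross (deriv (Z k) σ) (y-Z k σ))→(∀ y, v y = u X y+(1/2:ℝ)•y-α•cross (EuclideanSpace.single 2 1) y)→(∀ j, A j = fderiv ℝ v (X j (c j)))→(∀ Z j τ, T Z j τ = (u Z (Z j τ)+(1/2:ℝ)•Z j τ-α•cross (EuclideanSpace.single 2 1) (Z j τ))-(⟪u Z (Z j τ)+(1/2:ℝ)•Z j τ-α•cross (EuclideanSpace.single 2 1) (Z j τ), deriv (Z j) τ⟫_ℝ/‖deriv (Z j) τ‖^2)•deriv (Z j) τ)→(∃ ψ : Fin N → ℝ → EuclideanSpace ℝ (Fin 3), (∀ j, ContDiff ℝ 1 (ψ j)) ∧ (0 < ∑ j, ∫ τ in {τ : ℝ | ‖X j τ‖ ≤ Rb*√(Γ*Real.log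 Γ)}, ‖ψ j τ‖) ∧ (√Γ / cnd * ∑ j, ∫ τ in {τ : ℝ | ‖X j τ‖ ≤ Rb*√(Γ*Real.log Γ)}, ‖ψ j τ‖ ≤ ∑ j, ∫ τ in {τ : ℝ | ‖X j τ‖ ≤ Rb*√(Γ*Real.log Γ)}, ⟪ψ j τ, (cross (EuclideanSpace.single 2 1) (X j τ)-⟪cross (EuclideanSpace.single 2 1) (X j τ), deriv (X j) τ⟫_ℝ•deriv (X j) τ)⟫_ℝ) ∧ (∀ k, ∀ σ ∈ {σ : ℝ | ‖X k σ‖ ≤ Rb * √(Γ * Real.log Γ)}, ((∑ k', (Γ * γ k' / (4 * Real.pi)) • (∫ u, ((-3 * ((‖X k σ - X k' u‖ ^ 2 + Real.exp (-(1+Real.eulerMascheroniConstant-Real.log 2)) * Aa k' u) ^ (5 / 2 : ℝ))⁻¹ * ⟪(ψ k σ - ⟪ψ k σ, deriv (X k) σ⟫ • deriv (X k) σ), cross (deriv (X k') u) (X k σ - X k' u)⟫) • (X k σ - X k' u) + ((‖X k σ - X k' u‖ ^ 2 + Real.exp (-(1+Real.eulerMascheroniConstant-Real.log 2)) * Aa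 k' u) ^ (3 / 2 : ℝ))⁻¹ • cross (ψ k σ - ⟪ψ k σ, deriv (X k) σ⟫ • deriv (X k) σ) (deriv (X k') u)))) + (∑ j, (Γ * γ k / (4 * Real.pi)) • ((∫ τ in {σ : ℝ | ‖X j σ‖ ≤ Rb * √(Γ * Real.log Γ)}, ((3 * ((‖X j τ - X k σ‖ ^ 2 + Real.exp (-(1+Real.eulerMascheroniConstant-Real.log 2)) * Aa k σ) ^ (5 / 2 : ℝ))⁻¹ * ⟪(ψ j τ - ⟪ψ j τ, deriv (X j) τ⟫ • deriv (X j) τ), cross (deriv (X k) σ) (X j τ - X k σ)⟫) • (X j τ - X k σ) - ((‖X j τ - X k σ‖ ^ 2 + Real.exp (-(1+Real.eulerMascheroniConstant-Real.log 2)) * Aa k σ) ^ (3 / 2 : ℝ))⁻¹ • cross (ψ j τ - ⟪ψ j τ, deriv (X j) τ⟫ • deriv (X j) τ) (deriv (X k) σ))) - (∫ τ in {σ : ℝ | ‖X j σ‖ ≤ Rb * √(Γ * Real.log Γ)}, ((3 * ⟪X j τ - X k σ, deriv (X k) σ⟫ * ((‖X j τ - X k σ‖ ^ 2 + Real.exp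 (-(1+Real.eulerMascheroniConstant-Real.log 2)) * Aa k (c k)) ^ (5 / 2 : ℝ))⁻¹) • cross (ψ j τ - ⟪ψ j τ, deriv (X j) τ⟫ • deriv (X j) τ) (X k σ - X j τ) + ((‖X j τ - X k σ‖ ^ 2 + Real.exp (-(1+Real.eulerMascheroniConstant-Real.log 2)) * Aa k (c k)) ^ (3 / 2 : ℝ))⁻¹ • cross (ψ j τ - ⟪ψ j τ, deriv (X j) τ⟫ • deriv (X j) τ) (deriv (X k) σ))))) + ((1 / 2 : ℝ) • (ψ k σ - ⟪ψ k σ, deriv (X k) σ⟫ • deriv (X k) σ) + α • cross (EuclideanSpace.single 2 1) (ψ k σ - ⟪ψ k σ, deriv (X k) σ⟫ • deriv (X k) σ)) + (deriv (w k) σ • (ψ k σ - ⟪ψ k σ, deriv (X k) σ⟫ • deriv (X k) σ) + w k σ • (deriv (ψ k) σ - (⟪deriv (ψ k) σ, deriv (X k) σ⟫ + ⟪ψ k σ, deriv (deriv (X k)) σ⟫) • deriv (X k) σ - ⟪ψ k σ, deriv (X k) σ⟫ • deriv (deriv (X k)) σ))) = 0))))) →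
    ((open Literature.Analysis.FluidPDE in ∀ (N : ℕ) (δ ρ K Λ Rw cg θ₀ KA : ℝ), 0 < N → 0 < δ → 0 < ρ → 0 < Rw → 0 < cg → 0 < θ₀ → ∃ Rb₀ : ℝ, 0 < Rb₀ ∧ ∀ Rb : ℝ, 0 < Rb → Rb ≤ Rb₀ → ∀ b : ℝ, ∃ (cnd Γ₀ : ℝ), 0 < cnd ∧ ∀ Γ : ℝ, Γ₀ ≤ Γ → ∀ (γ : Fin N → ℝ) (α : ℝ) (X : Fin N → ℝ → EuclideanSpace ℝ (Fin 3)) (w : Fin N → ℝ → ℝ) (c : Fin N → ℝ) (Aa : Fin N → ℝ → ℝ), (∀ (u:(Fin N → ℝ → EuclideanSpace ℝ (Fin 3)) → EuclideanSpace ℝ (Fin 3) → EuclideanSpace ℝ (Fin 3)) (v:EuclideanSpace ℝ (Fin 3) → EuclideanSpace ℝ (Fin 3)) (A:Fin N → (EuclideanSpace ℝ (Fin 3) →L[ℝ] EuclideanSpace ℝ (Fin 3))) (T:(Fin N → ℝ → EuclideanSpace ℝ (Fin 3)) → Fin N → ℝ → EuclideanSpace ℝ (Fin 3)), (∀ Z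 y, u Z y = ∑ k, (Γ*γ k/(4*Real.pi))•∫ σ:ℝ, ((‖y-Z k σ‖^2+Real.exp (-(1+Real.eulerMascheroniConstant-Real.log 2))*Aa k σ)^(3/2:ℝ))⁻¹•cross (deriv (Z k) σ) (y-Z k σ))→(∀ y, v y = u X y+(1/2:ℝ)•y-α•cross (EuclideanSpace.single 2 1) y)→(∀ j, A j = fderiv ℝ v (X j (c j)))→(∀ Z j τ, T Z j τ = (u Z (Z j τ)+(1/2:ℝ)•Z j τ-α•cross (EuclideanSpace.single 2 1) (Z j τ))-(⟪u Z (Z j τ)+(1/2:ℝ)•Z j τ-α•cross (EuclideanSpace.single 2 1) (Z j τ), deriv (Z j) τ⟫_ℝ/‖deriv (Z j) τ‖^2)•deriv (Z j) τ)→(α ≠ 0 ∧ (∀ j, γ j ≠ 0) ∧ (∀ j, ContDiff ℝ 2 (X j) ∧ Differentiable ℝ (w j)∧(∀ τ, ‖deriv (X j) τ‖ = 1)∧(∀ τ, ‖iteratedDeriv 2 (X j) τ‖*√Γ≤K) ∧ Tendsto (fun τ => ‖X j τ‖) (cocompact ℝ) atTop) ∧ (∀ j k, j ≠ k → ∀ τ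 σ, ρ*√Γ≤‖X j τ-X k σ‖) ∧ (∀ j τ σ, ρ*√Γ≤|τ-σ| → cg*ρ*√Γ≤‖X j τ-X j σ‖) ∧ (∀ j τ, cg*|τ-c j|≤Rw*√Γ+‖X j τ‖) ∧ (∀ j τ, w j τ = ⟪v (X j τ), deriv (X j) τ⟫_ℝ) ∧ (∀ j τ, ‖X j τ‖≤Rb*√(Γ*Real.log Γ) → v (X j τ) = w j τ•deriv (X j) τ) ∧ (∀ j, ‖X j (c j)‖≤Rw*√Γ) ∧ (∀ j, |⟪deriv (X j) (c j), EuclideanSpace.single 2 1⟫_ℝ|≤1-θ₀) ∧ (θ₀≤|α| ∧ |α|≤θ₀⁻¹ ∧ ∀ j, θ₀≤|γ j| ∧ |γ j|≤θ₀⁻¹) ∧ (∀ j, w j (c j) = 0 ∧ (∀ τ, w j τ = 0 → τ = c j) ∧ 3/2+δ≤deriv (w j) (c j) ∧ deriv (w j) (c j)≤Λ) ∧ (∀ j, Differentiable ℝ (Aa j) ∧ (∀ τ, 0 < Aa j τ) ∧ 1≤KA*Aa j (c j) ∧ ∀ τ, ‖X j τ‖≤2*Rb*√(Γ*Real.log Γ)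 → Aa j τ = Aa j (c j)) ∧ (∀ j τ, Rw^2*Γ*Aa j τ≤KA*(Rw^2*Γ+‖X j τ‖^2)))) → ((∀ j τ σ, ‖deriv (X j) τ - deriv (X j) σ‖ ≤ Rb) ∧ (∀ j τ, |deriv (w j) τ| ≤ Λ) ∧ (∀ j τ, Λ⁻¹ ≤ Aa j τ)) → (∀ (u:(Fin N → ℝ → EuclideanSpace ℝ (Fin 3)) → EuclideanSpace ℝ (Fin 3) → EuclideanSpace ℝ (Fin 3)) (v:EuclideanSpace ℝ (Fin 3) → EuclideanSpace ℝ (Fin 3)) (A:Fin N → (EuclideanSpace ℝ (Fin 3) →L[ℝ] EuclideanSpace ℝ (Fin 3))) (T:(Fin N → ℝ → EuclideanSpace ℝ (Fin 3)) → Fin N → ℝ → EuclideanSpace ℝ (Fin 3)), (∀ Z y, u Z y = ∑ k, (Γ*γ k/(4*Real.pi))•∫ σ:ℝ, ((‖y-Z k σ‖^2+Real.exp (-(1+Real.eulerMascheroniConstant-Real.log 2))*Aa k σ)^(3/2:ℝ))⁻¹•cross (deriv (Z k) σ) (y-Z k σ))→(∀ y, v y = u X y+(1/2:ℝ)•y-α•cross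 (EuclideanSpace.single 2 1) y)→(∀ j, A j = fderiv ℝ v (X j (c j)))→(∀ Z j τ, T Z j τ = (u Z (Z j τ)+(1/2:ℝ)•Z j τ-α•cross (EuclideanSpace.single 2 1) (Z j τ))-(⟪u Z (Z j τ)+(1/2:ℝ)•Z j τ-α•cross (EuclideanSpace.single 2 1) (Z j τ), deriv (Z j) τ⟫_ℝ/‖deriv (Z j) τ‖^2)•deriv (Z j) τ)→(∀ Y:Fin N → ℝ → EuclideanSpace ℝ (Fin 3), (∀ j, ContDiff ℝ 2 (Y j))→(∀ j τ, ⟪Y j τ, deriv (X j) τ⟫_ℝ = 0) → (∀ j τ, Rb*√(Γ*Real.log Γ) < ‖X j τ‖ → Y j τ = 0) → ∑ j, ⟪Y j (c j), cross (EuclideanSpace.single 2 1) (X j (c j))⟫_ℝ = 0 → (∀ j τ, ‖Y j τ‖+‖deriv (Y j) τ‖+‖iteratedDeriv 2 (Y j) τ‖≤(1+|τ-c j|)^b) → ∀ dα L:ℝ, (∀ j τ, ‖X j τ‖≤Rb*√(Γ*Real.log Γ) → ‖deriv (fun s:ℝ => T (fun k σ => X k σ+s•Y k σ) j τ) 0-dα•(cross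 (EuclideanSpace.single 2 1) (X j τ)-⟪cross (EuclideanSpace.single 2 1) (X j τ), deriv (X j) τ⟫_ℝ•deriv (X j) τ)‖≤L) → |dα| * √Γ≤cnd*L)))) := by
  intro hR
  apply rateRow13RFlat_of_cokernelCertificate
  intro N δ ρ K Λ Rw cg θ₀ KA hN hδ hρ hRw hcg hθ₀
  obtain ⟨Rb₀, hRb₀, hfam⟩ := hR N δ ρ K Λ Rw cg θ₀ KA hN hδ hρ hRw hcg hθ₀
  refine ⟨Rb₀, hRb₀, fun Rb hRb hRble => ?_⟩
  obtain ⟨cnd, Γ₀, hcnd, hΓfam⟩ := hfam Rb hRb hRble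
  refine ⟨cnd, max Γ₀ 2, hcnd, fun Γ hΓle => ?_⟩
  have hΓ₀ : Γ₀ ≤ Γ := le_trans (le_max_left _ _) hΓle
  have hΓ1 : 1 < Γ := by linarith [le_max_right Γ₀ 2]
  intro γ α X w c Aa hH hNS u v A T hu hv hA hT
  obtain ⟨ψ, hψ1, hmass, hfloor, hker⟩ := hΓfam Γ hΓ₀ γ α X w c Aa hH hNS u v A T hu hv hA hT
  refine ⟨ψ, fun j => (hψ1 j).continuous, hmass, hfloor, fun Y hY2 hYn hYoff hYph => ?_⟩
  refine ⟨fun j => integrableOn_inner_linearisedMap hN hδ hcg hH hNS hu hv hA hT ψ hψ1 Y hY2 hYoff j, ?_⟩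
  rw [clause_pairing_identity hN hδ hcg hRb hΓ1 hH hNS hu hv hA hT ψ hψ1 Y hY2 hYoff]
  refine Finset.sum_eq_zero fun k _ => ?_
  refine setIntegral_eq_zero_of_forall_eq_zero fun σ hσ => ?_
  rw [hker k σ hσ, inner_zero_left]

end Summit.NavierStokesRegularity.NavierStokesRegularity.Theorems.Clause13RAdjointKernelCertificate

end
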